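import Literature.MathematicalPhysics.QuantumFieldTheory.Balaban1983to89.B9Thm31SiteGsqRecordCutoffReg335Y
import Literature.MathematicalPhysics.QuantumFieldTheory.Balaban1983to89.B9WalkLettersCoordsS

/-!
# `Balaban1983to89.B9Eq346MixedLegAtCubesTorusL2` — T. Bałaban, *Propagators for lattice gauge theories in a background field*, Commun. Math. Phys. **99**
# (1985) 389–434 [Balaban1985BackgroundPropagators] Cor 3.6 p. 408 (*«constants independent of □»*) ∕ (3.46) p. 398 ∕ (3.87)–(3.90) pp. 408–410, by S. Agmon's
# method [Agmon1982]: ★★ **THE MIXED `L²` LEG `∇_{U,ν} h_□ G′_□(U) h_□ ∇*_{U,μ}` OF THE THEOREM-3.7 WALK AT THE GENUINE CUT-OFF `h_□ = hTY` AND DOMAIN `□̃(c) = cubeDomY`,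
# BLOCK `s` → BLOCK `t`, WITH A MEMBER- AND □-UNIFORM CONSTANT** — dag-n06-w1's `hs_restrict_cdS_hTY_GsqY_hTY_cdsS_le_distT` (file 25: the partition of record, any
# domain `D`, level-dependent constant) at `D = □̃(c)`, the level window of `□̃` absorbing the `L^{2j}` factors into `(∂h_□)² ≲ (M_hLʲ⁺¹)⁻²`

statement-level skeleton of published theorems with citation tags; proofs where landed; nothing here is a claim about the Yang–Mills mass gap

THE PRINT.  p. 398 (3.46): *«‖h∇_UG′(U)∇\*_Uλ‖ ≤ B₀·e^{−δ₀d(y,y′)}‖h‖‖λ‖»* (order zero); p. 408, Cor 3.6: the estimates of Thm 3.1 hold for `G′_□(U)` *«with constants independent of □»*;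
p. 408: *«We take the partition of unity {h_□} defined at the end of Sect. A in [4]»*; [4] p. 247: *«|∂h_□| ≤ O(1)(MLʲη)⁻¹»*; p. 235: □̃ = the cube enlarged by neighbouring blocks
(levels `j−1 ≤ j(a) ≤ j+1`, the tree's `B6Cover236QbigOverlapV1.window_and_congr_of_mem_QbigT`); [4] (2.46) p. 231 (the block distance).

WHY THIS FILE (cell context; N06 rows 18 — the Theorem-3.7 walk's `L²` legs; the located hand «coordinate reading of the rows-18 L² legs» TAKEN by width seat
`pub-ymgap-dag-n06-w7` on the knit owner dag-n06-d's word, pub-ymgap bus 2026-08-28).  The N06 certificate displays `h36H ∋ L2MixedLegs37 (𝔬 x) (𝔡 x) 1 (H x) (SM x) BM δ₀ U`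
(dag-n06-k `B9RWSums346MixedPair`: per cube `c` and directions `ν μ`, `BlockBd blk blk (Dd ν ∘ (M_{h_c} G′_c M_{h_c}) ∘ Dsd μ) (1_{SM c}(a)·BM·e^{−δ₀d})`).  Its analytic content at
node00-def-Y's genuine letters is dag-n06-w1's files 24–25 (`B9Thm31SiteGsqBlockDistReg335Y`, `…RecordCutoffReg335Y.hs_restrict_cdS_hTY_GsqY_hTY_cdsS_le_distT`), whose constant `4(10 + κ²(16L^{2j_A} + 160L^{2(lev s+1)}) + 256κ⁴L^{2j_A}L^{2(lev s+1)})`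
depends on the LEVELS of the output set and of the source block through the cut-off's bond difference bound `κ`.  THIS FILE removes that dependence AT THE PARTITION OF
RECORD `h_c = hTY i c` on the domain `cubeDomY x c`:
* §1 LEVEL ∕ SUPPORT BOOKKEEPING: ★ `mem_cubeDomY_of_hTY_shiftY_ne_zero` (`h_c(z+e_ν) ≠ 0 ⟹ z ∈ □̃(c)`, chart geometry `B6CubeMoutV1` at distance 1), `cdS_cutMulY_apply_eq_zero_of_not_mem`
  (the leg's OUTPUT lives on `□̃(c)`: print's `S_□`, dag-n06-d's `SblkY`), `lev_le_of_hTY_ne_zero` (`h_c(z) ≠ 0 ⟹ lev y(z) ≤ j(c)+1`, the window of `□̃`), `lev_le_of_hTY_shiftY_ne_zero` (`h_c(z+e_ν) ≠ 0 ⟹ lev y(z) ≤ j(c)+2`,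
  one lattice step changes the level by `≤ 1`), `cdS_cutMulY_apply_eq_zero_of_lev` (the mixed leg's OUTPUT vanishes on blocks of level `> j(c)+2`),
  `cutMulY_cdsS_eq_zero_of_lev` (its INPUT `M_{h_c}∇\*_μλ` vanishes when `λ` sits in a block of level `> j(c)+2`), `kappa_sq_pow_le` (`κ_c²·L^{2(j(c)+3)} ≤ (5C₁∕8)²·L⁴`,
  `κ_c = C₁∕((8∕5)·M_h·L^{j(c)+1})`, `M_h ≥ 1`).
* §2 ★★ `hs_block_cdS_hTY_GsqY_hTY_cdsS_le` — for `λ` carried by the torus block `s`, every block `t`, every cube `c`, directions `ν μ`: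
  `Σ_{z∈Δ(t)} HS((∇_{U,ν}M_{h_c}G′_c(U)M_{h_c}∇\*_{U,μ}λ)(z)) ≤ (40 + 704K + 1024K²)·(e^{δ₀((d_T(t,s)−1)∕(2L) − 1)})⁻²·‖λ‖²₁`, `K = (5C₁∕8)²L⁴`, `δ₀ = 1∕(4(d+2))` — print's
  «constants independent of □», member-uniform (no `M_h`, no level, no `k`).
HONEST SCOPE.  One instantiation + level bookkeeping on top of landed files; the analytic input is dag-n06-w1's theorem (proved, hypothesis-free on the (3.35) class); nothing of
[B9] beyond it is asserted; the coordinate ∕ block-`L²` reading at the knit's models is the sequel `B9Eq346MixedLegAtPinsL2`; the second-order leg `L2SecondLegs37` and the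
A-side `310` twins are NOT here.  Count-neutral; N06 NOT discharged; K1⁷ NOT closed; one finite lattice at a time — nothing continuum ∕ OS ∕ mass gap ∕ Clay.  Cell `pub-ymgap`
(HUMAN RULING D-0062 ∕ D-0154), Track A node N06 [B9], width seat `pub-ymgap-dag-n06-w7` (g0), 2026-08-28.  NEW file; imports two BUILT modules; nothing landed is modified.
-/

noncomputable section

namespace Literature.MathematicalPhysics.QuantumFieldTheory.Balaban1983to89.B9Eq346MixedLegAtCubesTorusL2

open Literature.MathematicalPhysics.QuantumFieldTheory.Balaban1983to89
open Node00 B6KLevelCensusIndexV1 B6Geom246MultiLevelBox B6MultiLevelBoxOperator B6MultiLevelTorusOperator B6GlobalChartV1 B9BackgroundsKLevelV1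
  B9Eq39Adjoint B9Thm311ReadingCoords B6Geom246MultiLevelTorus B9Thm31SiteGsqBlockDistReg335Y B9Thm31SiteGsqRecordCutoffReg335Y
open Literature.MathematicalPhysics.QuantumFieldTheory.Balaban1983to89.B9Ineq369CurvatureSmallAtLettersY (hs_nonneg)
open Literature.MathematicalPhysics.QuantumFieldTheory.Balaban1983to89.B9Thm311DeltaPrimePos (trIP_self_nonneg)
open Literature.MathematicalPhysics.QuantumFieldTheory.Balaban1983to89.B9Thm37CubeCoverCommutators (cutMulY cutMulY_apply hTY hTY_apply one_le_Mh_and_P)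
open Literature.MathematicalPhysics.QuantumFieldTheory.Balaban1983to89.B6Partition118KLevelFineSizes (C1F C1F_nonneg)
open Literature.MathematicalPhysics.QuantumFieldTheory.Balaban1983to89.B6Cover236MultiLevelBlocks (cubes)
open Literature.MathematicalPhysics.QuantumFieldTheory.Balaban1983to89.B6Cover236QbigOverlapV1 (window_and_congr_of_mem_QbigT)
open Literature.MathematicalPhysics.QuantumFieldTheory.Balaban1983to89.B9WalkLettersCoordsS (cubeBlksY cubeDomY two_le_Mh four_le_P two_L_le_R mem_cubeDomY_of_hTY_ne_zero)
open Literature.MathematicalPhysics.QuantumFieldTheory.Balaban1983to89.B6Partition118KLevelTorusCentral (QbigT σch hT_eq_hF_cc one_le_of_four_le)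
open Literature.MathematicalPhysics.QuantumFieldTheory.Balaban1983to89.B6TorusDepthDistance (blkOf_eq_blkMap_symm)
open Literature.MathematicalPhysics.QuantumFieldTheory.Balaban1983to89.B6CubeMoutV1 (blkOf_mem_Qbig_of_near_hF)
open Literature.MathematicalPhysics.QuantumFieldTheory.Balaban1983to89.B9Thm37CommutatorBound389 (torusSupNorm_sub_shiftY_le_one)
open Literature.MathematicalPhysics.QuantumFieldTheory.Balaban1983to89.B6Eq238MultiLevelTorus (svec)
open Literature.MathematicalPhysics.QuantumFieldTheory.Balaban1983to89.B4TorusKernel.MultiPeriod (torusSupNorm)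
open Literature.MathematicalPhysics.QuantumFieldTheory.Balaban1983to89.B9PinMembersKLevelV1 (MemberY geo9Y)
open Literature.MathematicalPhysics.QuantumFieldTheory.Balaban1983to89.Node00.OpsYLocalInverse (GsqY)
open Literature.MathematicalPhysics.QuantumFieldTheory.Balaban1983to89.Node00.OpsYNablaBridge (cdS_apply cdsS_apply)
open scoped Matrix Matrix.Norms.L2Operator

variable {d ℓ : ℕ} {hd : 1 ≤ d + 1} {hL : Odd (ℓ + 1) ∧ 1 < ℓ + 1} {b₀ b₁ : ℝ} {Mstar : ℕ}
variable (x : MemberY d ℓ hd hL b₀ b₁ Mstar) {N : ℕ} {G : Subgroup (Matrix (Fin N) (Fin N) ℂ)ˣ}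

/-! ## §1 Level bookkeeping at the partition of record -/

section Levels

/-- `h_c(z) ≠ 0 ⟹` the block of `z` lies in `□̃(c)`, hence has level `≤ j(c) + 1` (the window of `□̃`). [cite: Balaban1984PropagatorsII, p.235 («□̃»), (2.134) p.247, bookkeeping] -/
theorem lev_le_of_hTY_ne_zero (c : ↥(cubes x.toKIdx.D.toDomains)) {z : SiteY x.toKIdx} (h : hTY x.toKIdx c z ≠ 0) :
    (blkOf x.toKIdx.D.toDomains z).1.1 ≤ c.1.1 + 1 := by
  have hz := mem_cubeDomY_of_hTY_ne_zero x c h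
  unfold cubeDomY at hz
  rw [Finset.mem_filter] at hz
  have hmem : blkOf x.toKIdx.D.toDomains z ∈ B6Partition118KLevelTorusCentral.QbigT x.toKIdx.D (one_le_Mh_and_P x.toKIdx).1 (four_le_P x) c := hz.2
  exact (window_and_congr_of_mem_QbigT x.toKIdx.D hL (two_le_Mh x) x.toKIdx.hR2 (one_le_Mh_and_P x.toKIdx).1 (four_le_P x) hmem).1.2

/-- `h_c(z + e_ν) ≠ 0 ⟹` the block of `z` has level `≤ j(c) + 2` (one lattice step changes the level by `≤ 1`). [cite: Balaban1984PropagatorsII, (2.2) p.224, p.235, bookkeeping] -/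
theorem lev_le_of_hTY_shiftY_ne_zero (c : ↥(cubes x.toKIdx.D.toDomains)) (ν : Fin (d + 1)) {z : SiteY x.toKIdx} (h : hTY x.toKIdx c (shiftY x.toKIdx ν z) ≠ 0) :
    (blkOf x.toKIdx.D.toDomains z).1.1 ≤ c.1.1 + 2 := by
  have h1 := lev_le_of_hTY_ne_zero x c h
  have h2 := lev_shiftY_symm_le x.toKIdx ν (shiftY x.toKIdx ν z)
  rw [Equiv.symm_apply_apply] at h2
  omega

/-- ★ **A BACKWARD LATTICE NEIGHBOUR OF `supp h_c` LIES IN `□̃(c)`**: `h_c(z + e_ν) ≠ 0 ⟹ z ∈ cubeDomY x c` — the chart geometry of lit-balaban's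
`B6CubeMoutV1.blkOf_mem_Qbig_of_near_hF` (a site within torus distance `S_j∕2` of `supp h^F_□` has its block in `Qbig`, `M_h ≥ 8`) at distance `1 ≤ S_j∕2`, read back on the
torus through the canonical chart translation `σ_c`. [cite: Balaban1984PropagatorsII, p.235 («□̃»), p.239, (2.45)–(2.46) p.231; Balaban1985BackgroundPropagators, (3.87) p.409, bookkeeping] -/
theorem mem_cubeDomY_of_hTY_shiftY_ne_zero (c : ↥(cubes x.toKIdx.D.toDomains)) (ν : Fin (d + 1)) {z : SiteY x.toKIdx}
    (h : hTY x.toKIdx c (shiftY x.toKIdx ν z) ≠ 0) : z ∈ cubeDomY x c := by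
  obtain ⟨hMh1, -⟩ := one_le_Mh_and_P x.toKIdx
  have hP4 := four_le_P x
  have hR : 2 * (ℓ + 1) ≤ x.toKIdx.R := two_L_le_R x
  unfold cubeDomY cubeBlksY
  rw [Finset.mem_filter]
  refine ⟨Finset.mem_univ _, ?_⟩
  rw [hTY_apply, hT_eq_hF_cc hMh1 hP4 c] at h
  have hS2 : (1 : ℝ) ≤ (bigSide ℓ x.toKIdx.Mh c.1.1 : ℝ) / 2 := by
    have hb : 8 ≤ bigSide ℓ x.toKIdx.Mh c.1.1 := by
      unfold bigSide
      calc 8 = 8 * 1 := by norm_num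
        _ ≤ x.toKIdx.Mh * (ℓ + 1) ^ (c.1.1 + 1) := Nat.mul_le_mul x.toKIdx.hM8 (Nat.one_le_pow _ _ (Nat.succ_pos ℓ))
    have hb' : (8 : ℝ) ≤ (bigSide ℓ x.toKIdx.Mh c.1.1 : ℝ) := by exact_mod_cast hb
    linarith
  have hdist : torusSupNorm (N0 ℓ x.toKIdx.Mh x.toKIdx.k x.toKIdx.P') (((σch x.toKIdx.D c).symm z).1 - ((σch x.toKIdx.D c).symm (shiftY x.toKIdx ν z)).1)
      ≤ (bigSide ℓ x.toKIdx.Mh c.1.1 : ℝ) / 2 := by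
    rw [tshift_symm_apply, tshift_symm_apply, torusSupNorm_tshift_sub]
    exact (torusSupNorm_sub_shiftY_le_one x.toKIdx ν z).1.trans hS2
  unfold QbigT
  rw [blkOf_eq_blkMap_symm (D := x.toKIdx.D) hMh1 (one_le_of_four_le hP4) (svec ℓ x.toKIdx.k c.1.1 c.1.2) z]
  exact Finset.mem_image_of_mem _ (blkOf_mem_Qbig_of_near_hF x.toKIdx.D x.toKIdx.hM8 hR x.toKIdx.hP5 hP4 c h hdist)

/-- ★ **THE OUTPUT OF THE MIXED LEG LIVES ON `□̃(c)`**: `(∇_{U,ν}M_{h_c}F)(z) = R(U_ν(z))·h_c(z+e_ν)F(z+e_ν) − h_c(z)F(z) = 0` for `z ∉ cubeDomY x c` (print's `S_□` for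
this leg is the ordinary one). [cite: Balaban1985BackgroundPropagators, (3.3) p.390, (3.87) p.409; Balaban1984PropagatorsII, p.235, bookkeeping] -/
theorem cdS_cutMulY_apply_eq_zero_of_not_mem (c : ↥(cubes x.toKIdx.D.toDomains)) (U : CfgY (Matrix (Fin N) (Fin N) ℂ) x.toKIdx) (ν : Fin (d + 1))
    (F : SiteY x.toKIdx → Matrix (Fin N) (Fin N) ℂ) {z : SiteY x.toKIdx} (hz : z ∉ cubeDomY x c) :
    cdS x.toKIdx U ν (cutMulY (hTY x.toKIdx c) F) z = 0 := by
  have h0 : hTY x.toKIdx c z = 0 := by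
    by_contra h; exact hz (mem_cubeDomY_of_hTY_ne_zero x c h)
  have h1 : hTY x.toKIdx c (shiftY x.toKIdx ν z) = 0 := by
    by_contra h; exact hz (mem_cubeDomY_of_hTY_shiftY_ne_zero x c ν h)
  rw [cdS_apply, cutMulY_apply, cutMulY_apply, h0, h1]
  simp

/-- the OUTPUT of the mixed leg vanishes on every block of level `> j(c) + 2`: `(∇_{U,ν}M_{h_c}F)(z) = R(U_ν(z))(h_c(z+e_ν)F(z+e_ν)) − h_c(z)F(z)`.
[cite: Balaban1985BackgroundPropagators, (3.3) p.390, p.408; Balaban1984PropagatorsII, p.235, bookkeeping] -/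
theorem cdS_cutMulY_apply_eq_zero_of_lev (c : ↥(cubes x.toKIdx.D.toDomains)) (U : CfgY (Matrix (Fin N) (Fin N) ℂ) x.toKIdx) (ν : Fin (d + 1))
    (F : SiteY x.toKIdx → Matrix (Fin N) (Fin N) ℂ) {z : SiteY x.toKIdx} (hz : c.1.1 + 2 < (blkOf x.toKIdx.D.toDomains z).1.1) :
    cdS x.toKIdx U ν (cutMulY (hTY x.toKIdx c) F) z = 0 := by
  have h0 : hTY x.toKIdx c z = 0 := by
    by_contra h; have := lev_le_of_hTY_ne_zero x c h; omega
  have h1 : hTY x.toKIdx c (shiftY x.toKIdx ν z) = 0 := by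
    by_contra h; have := lev_le_of_hTY_shiftY_ne_zero x c ν h; omega
  rw [cdS_apply, cutMulY_apply, cutMulY_apply, h0, h1]
  simp

/-- the INPUT `M_{h_c}∇\*_{U,μ}λ` of the mixed leg vanishes identically when `λ` is carried by a block `s` of level `> j(c) + 2`: `∇\*_μλ` lives on `Δ(s) ∪ (Δ(s)+e_μ)`,
whose blocks have level `≥ lev s − 1 > j(c) + 1`, outside `□̃(c)`. [cite: Balaban1985BackgroundPropagators, (3.8) p.392, p.408; Balaban1984PropagatorsII, p.235, bookkeeping] -/
theorem cutMulY_cdsS_eq_zero_of_lev (c : ↥(cubes x.toKIdx.D.toDomains)) (U : CfgY (Matrix (Fin N) (Fin N) ℂ) x.toKIdx) (μ : Fin (d + 1)) (s : BlkY x.toKIdx)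
    {Λ : SiteY x.toKIdx → Matrix (Fin N) (Fin N) ℂ} (hΛ : ∀ z, blkOf x.toKIdx.D.toDomains z ≠ s → Λ z = 0) (hs : c.1.1 + 2 < s.1.1) :
    cutMulY (hTY x.toKIdx c) (cdsS x.toKIdx U μ Λ) = 0 := by
  funext w
  rw [cutMulY_apply, Pi.zero_apply]
  by_cases hw : hTY x.toKIdx c w = 0
  · rw [hw]; simp
  · -- `h_c(w) ≠ 0`: `lev y(w) ≤ j(c)+1`, so neither `w` nor `w − e_μ` lies in `Δ(s)`
    have hlw := lev_le_of_hTY_ne_zero x c hw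
    have h1 : Λ w = 0 := hΛ w (by intro h; rw [h] at hlw; omega)
    have h2 : Λ ((shiftY x.toKIdx μ).symm w) = 0 := hΛ _ (by
      intro h
      have h3 := lev_shiftY_symm_le x.toKIdx μ w
      rw [h] at h3; omega)
    rw [cdsS_apply, h1, h2, R_zero, sub_zero, smul_zero]

/-- the cut-off's bond-difference bound absorbs the level factors: with `κ_c = C₁∕((8∕5)·(M_h·L^{j(c)+1}))` and `M_h ≥ 1`, `L ≥ 1`,
`κ_c² · L^{2(j(c)+3)} ≤ (5C₁∕8)² · L⁴`. [cite: Balaban1984PropagatorsII, p.247 («|∂h_□| ≤ O(1)(MLʲη)⁻¹»); Balaban1985BackgroundPropagators, Cor 3.6 p.408 («constants independent of □»)] -/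
theorem kappa_sq_pow_le (j : ℕ) :
    (C1F d ℓ / (8 / 5 * (bigSide ℓ x.toKIdx.Mh j : ℝ))) ^ 2 * ((((ℓ + 1) ^ (j + 3) : ℕ) : ℝ)) ^ 2
      ≤ (5 * C1F d ℓ / 8) ^ 2 * (((ℓ + 1 : ℕ) : ℝ)) ^ 4 := by
  have hMh : (1 : ℝ) ≤ (x.toKIdx.Mh : ℝ) := by exact_mod_cast (one_le_Mh_and_P x.toKIdx).1
  have hL1 : (1 : ℝ) ≤ ((ℓ + 1 : ℕ) : ℝ) := by exact_mod_cast Nat.succ_le_succ (Nat.zero_le ℓ)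
  set Lr : ℝ := ((ℓ + 1 : ℕ) : ℝ) with hLr
  have hLr0 : 0 < Lr := lt_of_lt_of_le one_pos hL1
  have hbig : (bigSide ℓ x.toKIdx.Mh j : ℝ) = (x.toKIdx.Mh : ℝ) * Lr ^ (j + 1) := by
    rw [hLr]; unfold bigSide; push_cast; ring
  have hpow : ((((ℓ + 1) ^ (j + 3) : ℕ) : ℝ)) = Lr ^ (j + 3) := by rw [hLr]; push_cast; ring
  rw [hbig, hpow]
  have hC := C1F_nonneg d ℓ
  have hLj : 0 < Lr ^ (j + 1) := pow_pos hLr0 _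
  -- `(C₁∕(8∕5·M_h·L^{j+1}))²·L^{2(j+3)} = (5C₁∕8)²·L⁴∕M_h²`
  have e : (C1F d ℓ / (8 / 5 * ((x.toKIdx.Mh : ℝ) * Lr ^ (j + 1)))) ^ 2 * (Lr ^ (j + 3)) ^ 2
      = (5 * C1F d ℓ / 8) ^ 2 * Lr ^ 4 * ((x.toKIdx.Mh : ℝ) ^ 2)⁻¹ := by
    field_simp
    ring
  rw [e]
  have hM2 : (1 : ℝ) ≤ (x.toKIdx.Mh : ℝ) ^ 2 := one_le_pow₀ hMh
  calc (5 * C1F d ℓ / 8) ^ 2 * Lr ^ 4 * ((x.toKIdx.Mh : ℝ) ^ 2)⁻¹ ≤ (5 * C1F d ℓ / 8) ^ 2 * Lr ^ 4 * 1 :=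
        mul_le_mul_of_nonneg_left (inv_le_one_of_one_le₀ hM2) (by positivity)
    _ = _ := by rw [mul_one]

end Levels

/-! ## §2 The mixed leg, block to block, with a member- and □-uniform constant -/

section Main

/-- ★★ **THE MIXED `L²` LEG `∇_{U,ν} h_c G′_c(U) h_c ∇\*_{U,μ}` AT THE PARTITION OF RECORD, BLOCK TO BLOCK, UNIFORM CONSTANT**: `G ≤ U(N)`, `N ≥ 1`, `0 ≤ c·M·α₀`,
`c·M·α₀·(d+1) ≤ 1∕16`, `U ∈ Reg335 c α₀`; for every cube `c`, directions `ν μ`, blocks `s t` and `λ` carried by `s`: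
`Σ_{z∈Δ(t)} HS((∇_{U,ν}M_{h_c}G′_c(U)M_{h_c}∇\*_{U,μ}λ)(z)) ≤ (40 + 704K + 1024K²)·‖λ‖²₁ ∕ (e^{δ₀((d_T(t,s)−1)∕(2L) − 1)})²`, `K = (5C₁∕8)²L⁴`, `δ₀ = 1∕(4(d+2))`.
[cite: Balaban1985BackgroundPropagators, Cor 3.6 p.408, Thm 3.1 (3.46) p.398, (3.87)–(3.89) p.409, p.397; Balaban1984PropagatorsII, (2.46) p.231, p.235, p.247; Agmon1982, Ch.1, Thm 1.5] -/
theorem hs_block_cdS_hTY_GsqY_hTY_cdsS_le [Nonempty (Fin N)] (hG : G ≤ B7Prop2Explicit.unitaryUnits (Matrix (Fin N) (Fin N) ℂ))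
    {U : CfgY (Matrix (Fin N) (Fin N) ℂ) x.toKIdx} {c₀ α₀ : ℝ} (hC0 : 0 ≤ c₀ * (geo9Y x).M * α₀) (hC1 : c₀ * (geo9Y x).M * α₀ * ((d : ℝ) + 1) ≤ 1 / 16)
    (hreg : (bg9K (Matrix (Fin N) (Fin N) ℂ) G x.toKIdx).Reg335 c₀ α₀ U) (c : ↥(cubes x.toKIdx.D.toDomains)) (ν μ : Fin (d + 1)) (s t : BlkY x.toKIdx)
    {Λ : SiteY x.toKIdx → Matrix (Fin N) (Fin N) ℂ} (hΛ : ∀ z, blkOf x.toKIdx.D.toDomains z ≠ s → Λ z = 0) :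
    ∑ z ∈ Finset.univ.filter (fun z => blkOf x.toKIdx.D.toDomains z = t),
        ∑ a, ∑ b, ‖cdS x.toKIdx U ν (cutMulY (hTY x.toKIdx c) (GsqY x.toKIdx (parSymY x.toKIdx) (cubeDomY x c) U
          (cutMulY (hTY x.toKIdx c) (cdsS x.toKIdx U μ Λ)))) z a b‖ ^ 2
      ≤ (40 + 704 * ((5 * C1F d ℓ / 8) ^ 2 * (((ℓ + 1 : ℕ) : ℝ)) ^ 4) + 1024 * ((5 * C1F d ℓ / 8) ^ 2 * (((ℓ + 1 : ℕ) : ℝ)) ^ 4) ^ 2)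
          / Real.exp ((1 / (4 * ((d : ℝ) + 2))) * (((((bondT x.toKIdx.D).dist t s : ℝ)) - 1) / (2 * ((ℓ + 1 : ℕ) : ℝ)) - 1)) ^ 2
        * trIP (fun _ => (1 : ℝ)) Λ Λ := by
  classical
  set K : ℝ := (5 * C1F d ℓ / 8) ^ 2 * (((ℓ + 1 : ℕ) : ℝ)) ^ 4 with hK
  set E : ℝ := Real.exp ((1 / (4 * ((d : ℝ) + 2))) * (((((bondT x.toKIdx.D).dist t s : ℝ)) - 1) / (2 * ((ℓ + 1 : ℕ) : ℝ)) - 1)) with hE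
  have hE0 : 0 < E := Real.exp_pos _
  have hK0 : 0 ≤ K := by positivity
  have hQ0 : 0 ≤ trIP (fun _ => (1 : ℝ)) Λ Λ := trIP_self_nonneg _ (fun _ => one_pos) Λ
  have hRHS0 : 0 ≤ (40 + 704 * K + 1024 * K ^ 2) / E ^ 2 * trIP (fun _ => (1 : ℝ)) Λ Λ := by positivity
  -- the degenerate level configurations: the leg vanishes
  by_cases ht : t.1.1 ≤ c.1.1 + 2
  swap
  · refine le_of_eq_of_le ?_ hRHS0
    refine Finset.sum_eq_zero fun z hz => ?_
    rw [Finset.mem_filter] at hz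
    rw [cdS_cutMulY_apply_eq_zero_of_lev x c U ν _ (by rw [hz.2]; omega)]
    simp
  by_cases hs : s.1.1 ≤ c.1.1 + 2
  swap
  · refine le_of_eq_of_le ?_ hRHS0
    refine Finset.sum_eq_zero fun z _ => ?_
    rw [cutMulY_cdsS_eq_zero_of_lev x c U μ s hΛ (by omega), map_zero]
    have h0 : cutMulY (hTY x.toKIdx c) (0 : SiteY x.toKIdx → Matrix (Fin N) (Fin N) ℂ) = 0 := map_zero _
    rw [h0]
    have h1 : cdS x.toKIdx U ν (0 : SiteY x.toKIdx → Matrix (Fin N) (Fin N) ℂ) = 0 := by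
      rw [← B9Ineq349SiteComposite.cdSL_apply, map_zero]
    rw [h1]
    change ∑ a, ∑ b, ‖(0 : Matrix (Fin N) (Fin N) ℂ) a b‖ ^ 2 = 0
    simp
  -- the main case: dag-n06-w1's file 25 at `h = hTY c`, `D = cubeDomY x c`, `A = Δ(t)`, `n = d_T(t,s)`, `j_A = lev t`
  set κ : ℝ := C1F d ℓ / (8 / 5 * (bigSide ℓ x.toKIdx.Mh c.1.1 : ℝ)) with hκ
  have hA : ∀ z ∈ Finset.univ.filter (fun z => blkOf x.toKIdx.D.toDomains z = t), (bondT x.toKIdx.D).dist t s ≤ (bondT x.toKIdx.D).dist (blkOf x.toKIdx.D.toDomains z) s := by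
    intro z hz; rw [Finset.mem_filter] at hz; rw [hz.2]
  have hjA : ∀ z ∈ Finset.univ.filter (fun z => blkOf x.toKIdx.D.toDomains z = t), (blkOf x.toKIdx.D.toDomains z).1.1 ≤ t.1.1 := by
    intro z hz; rw [Finset.mem_filter] at hz; rw [hz.2]
  have key := hs_restrict_cdS_hTY_GsqY_hTY_cdsS_le_distT x.toKIdx hG (U := U) hC0 hC1 hreg (cubeDomY x c) c ν μ s hΛ hA hjA
  rw [← hκ] at key
  refine key.trans (mul_le_mul_of_nonneg_right (div_le_div_of_nonneg_right ?_ (by positivity)) hQ0)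
  -- the level-dependent constant is below `40 + 704K + 256K²`
  have hκ0 : 0 ≤ κ := by rw [hκ]; exact div_nonneg (C1F_nonneg d ℓ) (by positivity)
  have hL1 : (1 : ℝ) ≤ ((ℓ + 1 : ℕ) : ℝ) := by exact_mod_cast Nat.succ_le_succ (Nat.zero_le ℓ)
  have hpow : ∀ m : ℕ, m ≤ c.1.1 + 3 → ((((ℓ + 1) ^ m : ℕ) : ℝ)) ^ 2 ≤ ((((ℓ + 1) ^ (c.1.1 + 3) : ℕ) : ℝ)) ^ 2 := by
    intro m hm
    have h1 : (((ℓ + 1) ^ m : ℕ) : ℝ) ≤ (((ℓ + 1) ^ (c.1.1 + 3) : ℕ) : ℝ) := by exact_mod_cast Nat.pow_le_pow_right (Nat.succ_pos ℓ) hm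
    exact pow_le_pow_left₀ (by positivity) h1 2
  have hKc := kappa_sq_pow_le x c.1.1
  rw [← hκ] at hKc
  have hA2 : κ ^ 2 * ((((ℓ + 1) ^ t.1.1 : ℕ) : ℝ)) ^ 2 ≤ K :=
    le_trans (mul_le_mul_of_nonneg_left (hpow t.1.1 (by omega)) (sq_nonneg κ)) hKc
  have hS2 : κ ^ 2 * ((((ℓ + 1) ^ (s.1.1 + 1) : ℕ) : ℝ)) ^ 2 ≤ K :=
    le_trans (mul_le_mul_of_nonneg_left (hpow (s.1.1 + 1) (by omega)) (sq_nonneg κ)) hKc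
  have h4 : κ ^ 4 * (((((ℓ + 1) ^ t.1.1 : ℕ) : ℝ)) ^ 2 * ((((ℓ + 1) ^ (s.1.1 + 1) : ℕ) : ℝ)) ^ 2) ≤ K ^ 2 := by
    have e : κ ^ 4 * (((((ℓ + 1) ^ t.1.1 : ℕ) : ℝ)) ^ 2 * ((((ℓ + 1) ^ (s.1.1 + 1) : ℕ) : ℝ)) ^ 2)
        = (κ ^ 2 * ((((ℓ + 1) ^ t.1.1 : ℕ) : ℝ)) ^ 2) * (κ ^ 2 * ((((ℓ + 1) ^ (s.1.1 + 1) : ℕ) : ℝ)) ^ 2) := by ring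
    rw [e, pow_two K]
    exact mul_le_mul hA2 hS2 (by positivity) hK0
  set Tt : ℝ := ((((ℓ + 1) ^ t.1.1 : ℕ) : ℝ)) ^ 2 with hTt
  set Ss : ℝ := ((((ℓ + 1) ^ (s.1.1 + 1) : ℕ) : ℝ)) ^ 2 with hSs
  have e : 4 * (10 + κ ^ 2 * (16 * Tt + 160 * Ss) + 256 * κ ^ 4 * (Tt * Ss))
      = 40 + 64 * (κ ^ 2 * Tt) + 640 * (κ ^ 2 * Ss) + 1024 * (κ ^ 4 * (Tt * Ss)) := by ring
  rw [e]
  linarith [hA2, hS2, h4, hK0]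

end Main

end Literature.MathematicalPhysics.QuantumFieldTheory.Balaban1983to89.B9Eq346MixedLegAtCubesTorusL2

end
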